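import Mathlib.RingTheory.MvPolynomial.Basic
import Mathlib.RingTheory.MvPolynomial.Homogeneous
import Mathlib.Algebra.CharP.Lemmas
import Mathlib.Algebra.CharP.Algebra
import Mathlib.Algebra.MvPolynomial.Monad
import Mathlib.FieldTheory.Finite.Basic
import Mathlib.RingTheory.Polynomial.ScaleRoots
import Mathlib.Algebra.Polynomial.Roots
import Mathlib.LinearAlgebra.Matrix.Determinant.Basic
import Mathlib.Data.ZMod.Basic
import Mathlib.Tactic.LinearCombination
import Mathlib.Tactic.Ring
import HarnessLib

/-!
# `TypeSeeds` (item stmt-Langlands-8609, support of route `TriangulineChamber`) — the typable kernels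

The item `TypeSeeds` (informal; no Lean decl exists in
`Summits/Langlands/Langlands/Theses/TriangulineChamber.lean`, the tree having no definite-unitary
algebraic automorphic forms `S(U^pK_p, σ)_𝔪` and no patched eigenvariety `X_p(ρ̄)`) says, in the
setting of Breuil–Hellmann–Schraen (arXiv:1411.7260 §3): for every place `v ∣ p` and every torsion
type `t_v ∈ Hom(μ(F_ṽ)², L×)` compatible with `det ρ̄_ṽ` (resp. every stable line `ℓ_v` of a reducible
generic `ρ̄_ṽ`) there is an automorphic `π` of the definite unitary group `G`, of level `U^pK_p` and
algebraic weight, lifting `ρ̄`, with `ρ_{π,ṽ}` crystalline strictly dominant φ-generic and irreducible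
of torsion type `t_v` (resp. ordinary along a lift of `ℓ_v`) — one automorphic SEED of `X_p(ρ̄)` over
every determinant-compatible type.

Its proof (evidence file `TypeSeeds-proof.md` attached to the item) is: start from one modular Serre
weight `V = σ̄_{k⁰}` of `ρ̄` (`S(U^pK_p, σ_{k⁰})_𝔪 ≠ 0`), and climb the **θ-tower**
`σ̄_{k⁰} = Sym^a ⊗ det^b ⊗ M' ↪ Sym^{a+j(q+1)} ⊗ det^{b-j} ⊗ M' = σ̄_{k^{(j)}}` given by multiplication
by the `j`-th power of the Dickson semi-invariant `θ = X^qY − XY^q` of `GL₂(𝔽_q)`; exactness of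
`S(U^pK_p, –)_𝔪` then gives automorphic forms of every weight `k^{(j)}`, whose crystalline points on
`X_tri^□(ρ̄_ṽ)` have tame torsion type `(e₁ + j, e₂ − j) ∈ (ℤ/(q−1))²` — all `q − 1` types of the
determinant class of `(e₁, e₂)`, which are exactly the determinant-compatible ones.  This replaces the
soft spot recorded on the item ("for `n_τ ≥ q²−1` every Serre weight of `GL₂(𝔽_q)` with compatible
central character is a JH constituent of `⊗_τ Sym^{n_τ} ⊗ det^{c_τ}`", no printed theorem number for
`q = p^f`, `f ≥ 2`) by an inclusion that holds for every `q`.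

This file proves the three purely algebraic kernels of that argument, which ARE typable today:

* `linear_form_pow_char_pow`, `theta_linear_substitution`: in characteristic `p`, for
  `𝔽_q`-rational `a b c d` (`x ^ q = x`, `q = p^n`), `θ(aX+bY, cX+dY) = (ad − bc)·θ(X, Y)` in `R[X, Y]`
  — `θ` spans the character `det` inside `Sym^{q+1}` of the standard representation of `GL₂(𝔽_q)`
  (over any `R ⊇ 𝔽_q` of characteristic `p`, e.g. `R = k_L` through a residue embedding
  `τ̄ : k_K → k_L`, which is how it is used on the `τ̄`-factor of a Serre weight);
  `theta_linear_substitution_finiteField` is the same for a matrix over a finite field `K` acting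
  on `R[X, Y]`, `R` any `K`-algebra.  [folklore; L. E. Dickson 1911; e.g. the proof of
  Lemma 3.1 of Ash–Stevens, *Modular forms in characteristic ℓ and special values of their
  L-functions*, Duke Math. J. 53 (1986), for `q = p`]
* `theta_isHomogeneous`, `theta_mul_injective`: `θ` is homogeneous of degree `q+1` and (over a
  domain) multiplication by `θ` is injective, so `f ↦ θ·f` is an equivariant embedding
  `Sym^N ⊗ det ↪ Sym^{N+q+1}` of spaces of binary forms.
* `X_mul_prod_linear_forms_eq_theta`: `θ = Y · ∏_{a ∈ 𝔽_q} (X − aY)` is the product of the `q + 1`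
  `𝔽_q`-rational linear forms (one per point of `ℙ¹(𝔽_q)`), via the univariate
  `∏_{a ∈ 𝔽_q} (T − a) = T^q − T` (`prod_X_sub_C_eq_X_pow_card_sub_X`) homogenised with Mathlib's
  `Polynomial.scaleRoots` (`prod_scaleRoots`, `scaleRoots_X_pow_sub_X`).  This is what identifies
  `Sym^M / θ·Sym^{M−q−1}` (`M ≥ q`) with the functions on `ℙ¹(𝔽_q)`, i.e. with a principal series of
  `GL₂(𝔽_q)`, in the positive-slope step of the seeding argument.
* `card_types_with_fixed_det`, `exists_shift_of_det_eq`: the type arithmetic — of the `m²` pairs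
  `(e₁, e₂) ∈ (ℤ/m)²` exactly `m` have a given sum (the route's count "`(q−1)²` characters of
  `μ_{q−1}²`, of which `q−1` are compatible with `det ρ̄_v`", `m = q−1`), and the shifts
  `(e₁ + j, e₂ − j)`, `0 ≤ j < m`, exhaust a sum class (the θ-tower reaches every
  determinant-compatible tame type).

Substitution is phrased with Mathlib's `MvPolynomial.bind₁` (`X 0 ↦ aX+bY`, `X 1 ↦ cX+dY`), the
`GL₂`-action on binary forms being absent from Mathlib as a named representation.  Nothing here is a
definition; no Literature fact is used.  Deliberately NOT here: Serre weights as `𝔽̄_p[GL₂(𝔽_q)]`-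
modules, Jordan–Hölder constituents, `S(U^pK_p, σ)_𝔪`, eigenvarieties (no tree vocabulary).
-/

set_option linter.dupNamespace false -- project-wide option (lakefile weak.linter.dupNamespace); `Summit.Langlands.Langlands` is the mandated namespace

namespace Summit.Langlands.Langlands.Theorems.TypeSeeds

open MvPolynomial

/-! ### The Dickson semi-invariant `θ = X^q Y − X Y^q` -/

/-- Frobenius-linearity of an `𝔽_q`-rational linear form [folklore]: in characteristic `p`, if
`a ^ p ^ n = a` and `b ^ p ^ n = b` (i.e. `a, b` are `𝔽_q`-rational, `q = p ^ n`), then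
`(a X + b Y) ^ q = a X ^ q + b Y ^ q` in `R[X, Y]`. -/
theorem linear_form_pow_char_pow {R : Type*} [CommRing R] (p n : ℕ) [Fact p.Prime] [CharP R p]
    {a b : R} (ha : a ^ p ^ n = a) (hb : b ^ p ^ n = b) :
    (C a * X 0 + C b * X 1 : MvPolynomial (Fin 2) R) ^ p ^ n =
      C a * X 0 ^ p ^ n + C b * X 1 ^ p ^ n := by
  rw [add_pow_char_pow, mul_pow, mul_pow, ← C_pow, ← C_pow, ha, hb]

/-- **The Dickson semi-invariant `θ = X^q Y − X Y^q` transforms by the determinant** [folklore]: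
in characteristic `p`, for `𝔽_q`-rational `a b c d ∈ R` (fixed by `x ↦ x ^ q`, `q = p ^ n`), the
linear substitution `X ↦ aX + bY`, `Y ↦ cX + dY` (Mathlib `bind₁`) gives
`θ(aX + bY, cX + dY) = (ad − bc) · θ(X, Y)`.  Hence `θ` spans the character `det` of `GL₂(𝔽_q)`
inside the binary forms of degree `q + 1`, and multiplication by `θ` is a `GL₂(𝔽_q)`-equivariant map
`Sym^N ⊗ det → Sym^{N+q+1}` — the weight-shifting map of the seeding argument for `TypeSeeds`
(it moves the tame torsion type of an algebraic weight by `(+1, −1)` and keeps every constituent).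
Proof: `(aX+bY)^q = aX^q + bY^q` (`linear_form_pow_char_pow`) and a two-term expansion. -/
theorem theta_linear_substitution {R : Type*} [CommRing R] (p n : ℕ) [Fact p.Prime] [CharP R p]
    {a b c d : R} (ha : a ^ p ^ n = a) (hb : b ^ p ^ n = b) (hc : c ^ p ^ n = c)
    (hd : d ^ p ^ n = d) :
    bind₁ (![C a * X 0 + C b * X 1, C c * X 0 + C d * X 1] : Fin 2 → MvPolynomial (Fin 2) R)
        (X 0 ^ p ^ n * X 1 - X 0 * X 1 ^ p ^ n : MvPolynomial (Fin 2) R) =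
      C (a * d - b * c) * (X 0 ^ p ^ n * X 1 - X 0 * X 1 ^ p ^ n : MvPolynomial (Fin 2) R) := by
  have hu := linear_form_pow_char_pow p n ha hb
  have hw := linear_form_pow_char_pow p n hc hd
  simp only [map_sub, map_mul, map_pow, bind₁_X_right, Matrix.cons_val_zero, Matrix.cons_val_one]
  linear_combination (C c * X 0 + C d * X 1 : MvPolynomial (Fin 2) R) * hu -
    (C a * X 0 + C b * X 1 : MvPolynomial (Fin 2) R) * hw

/-- Finite-field form of `theta_linear_substitution` [folklore]: for a finite field `K` with `q`
elements, any commutative `K`-algebra `R` (e.g. `k_L` over `k_K` through a residue embedding) and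
any matrix `g ∈ M₂(K)`, substituting `X ↦ g₀₀X + g₀₁Y`, `Y ↦ g₁₀X + g₁₁Y` in `θ = X^qY − XY^q ∈ R[X, Y]`
multiplies it by `det g`: `θ ∘ g = det(g) · θ`. -/
theorem theta_linear_substitution_finiteField {K R : Type*} [Field K] [Fintype K] [CommRing R]
    [Algebra K R] (g : Matrix (Fin 2) (Fin 2) K) :
    bind₁ (![C (algebraMap K R (g 0 0)) * X 0 + C (algebraMap K R (g 0 1)) * X 1,
             C (algebraMap K R (g 1 0)) * X 0 + C (algebraMap K R (g 1 1)) * X 1] :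
            Fin 2 → MvPolynomial (Fin 2) R)
        (X 0 ^ Fintype.card K * X 1 - X 0 * X 1 ^ Fintype.card K : MvPolynomial (Fin 2) R) =
      C (algebraMap K R g.det) *
        (X 0 ^ Fintype.card K * X 1 - X 0 * X 1 ^ Fintype.card K : MvPolynomial (Fin 2) R) := by
  rcases subsingleton_or_nontrivial R with hR | hR
  · exact Subsingleton.elim _ _
  obtain ⟨p, hchar⟩ := CharP.exists K
  haveI : CharP R p := charP_of_injective_algebraMap (algebraMap K R).injective p
  obtain ⟨n, hp, hq⟩ := FiniteField.card K p
  haveI : Fact p.Prime := ⟨hp⟩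
  have hfix : ∀ a : K, algebraMap K R a ^ p ^ (n : ℕ) = algebraMap K R a := fun a => by
    rw [← map_pow, ← hq, FiniteField.pow_card]
  have key := theta_linear_substitution p n (hfix (g 0 0)) (hfix (g 0 1)) (hfix (g 1 0))
    (hfix (g 1 1))
  rw [hq, Matrix.det_fin_two, (algebraMap K R).map_sub, (algebraMap K R).map_mul,
    (algebraMap K R).map_mul]
  exact key

/-- `θ = X^q Y − X Y^q` is homogeneous of degree `q + 1` [folklore] (so multiplication by `θ` maps
binary forms of degree `N` to binary forms of degree `N + q + 1`, `IsHomogeneous.mul`). -/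
theorem theta_isHomogeneous {R : Type*} [CommRing R] (q : ℕ) :
    (X 0 ^ q * X 1 - X 0 * X 1 ^ q : MvPolynomial (Fin 2) R).IsHomogeneous (q + 1) := by
  apply IsHomogeneous.sub
  · simpa using ((isHomogeneous_X R 0).pow q).mul (isHomogeneous_X R 1)
  · have := (isHomogeneous_X R (0 : Fin 2)).mul ((isHomogeneous_X R 1).pow q)
    simpa [Nat.add_comm] using this

/-- Multiplication by `θ = X^q Y − X Y^q` (`q ≠ 1`) is injective on `R[X, Y]` for a domain `R`
[folklore]: `θ ≠ 0` (its coefficient at `X^qY` is `1`), and `R[X, Y]` is a domain.  Hence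
`f ↦ θ f` embeds `Sym^N ⊗ det` into `Sym^{N+q+1}`. -/
theorem theta_mul_injective {R : Type*} [CommRing R] [IsDomain R] (q : ℕ) (hq : q ≠ 1) :
    Function.Injective fun f : MvPolynomial (Fin 2) R => (X 0 ^ q * X 1 - X 0 * X 1 ^ q) * f := by
  refine mul_right_injective₀ ?_
  intro h
  have := congr_arg (coeff (Finsupp.single 0 q + Finsupp.single 1 1)) h
  simp only [coeff_sub, coeff_zero] at this
  rw [show (X 0 ^ q * X 1 : MvPolynomial (Fin 2) R) =
        monomial (Finsupp.single 0 q + Finsupp.single 1 1) 1 by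
      rw [X_pow_eq_monomial, X, monomial_mul, mul_one],
    show (X 0 * X 1 ^ q : MvPolynomial (Fin 2) R) =
        monomial (Finsupp.single 0 1 + Finsupp.single 1 q) 1 by
      rw [X_pow_eq_monomial, X, monomial_mul, mul_one]] at this
  rw [coeff_monomial, coeff_monomial, if_pos rfl, if_neg] at this
  · simp at this
  · intro h'
    have := congr_arg (fun f => f 1) h'
    simp at this
    exact hq this

/-! ### `θ` as the product of the rational linear forms -/

/-- `Polynomial.scaleRoots` is multiplicative over finite products when there are no zero divisors
[folklore] (iterate Mathlib's `mul_scaleRoots_of_noZeroDivisors`). -/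
theorem prod_scaleRoots {R : Type*} [CommRing R] [NoZeroDivisors R] {ι : Type*} (s : Finset ι)
    (f : ι → Polynomial R) (r : R) :
    (∏ i ∈ s, f i).scaleRoots r = ∏ i ∈ s, (f i).scaleRoots r := by
  classical
  induction s using Finset.induction_on with
  | empty => simp
  | insert a s ha ih =>
    rw [Finset.prod_insert ha, Finset.prod_insert ha, Polynomial.mul_scaleRoots_of_noZeroDivisors,
      ih]

/-- In `K[T]`, `K` a finite field with `q` elements, `∏_{a ∈ K} (T − a) = T^q − T` [folklore]
(every element is a simple root of `T^q − T`, Mathlib `FiniteField.roots_X_pow_card_sub_X`). -/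
theorem prod_X_sub_C_eq_X_pow_card_sub_X (K : Type*) [Field K] [Fintype K] :
    (∏ a : K, (Polynomial.X - Polynomial.C a) : Polynomial K) =
      Polynomial.X ^ Fintype.card K - Polynomial.X := by
  have hmonic : (Polynomial.X ^ Fintype.card K - Polynomial.X : Polynomial K).Monic := by
    apply Polynomial.monic_X_pow_sub
    rw [Polynomial.degree_X]; exact_mod_cast Fintype.one_lt_card
  have hroots := FiniteField.roots_X_pow_card_sub_X K
  have hcard : Multiset.card (Polynomial.X ^ Fintype.card K - Polynomial.X : Polynomial K).roots =
      (Polynomial.X ^ Fintype.card K - Polynomial.X : Polynomial K).natDegree := by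
    rw [hroots, FiniteField.X_pow_card_sub_X_natDegree_eq K Fintype.one_lt_card]
    rfl
  have := Polynomial.prod_multiset_X_sub_C_of_monic_of_roots_card_eq hmonic hcard
  rw [hroots] at this
  rw [← this]
  rfl

/-- `scaleRoots` of `T^q − T` by `s` is `T^q − s^{q−1}·T` (`1 < q`) [folklore]: the homogenisation
of `T^q − T` in degree `q`. -/
theorem scaleRoots_X_pow_sub_X {A : Type*} [CommRing A] [Nontrivial A] (q : ℕ) (hq : 1 < q)
    (s : A) :
    (Polynomial.X ^ q - Polynomial.X : Polynomial A).scaleRoots s =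
      Polynomial.X ^ q - Polynomial.C (s ^ (q - 1)) * Polynomial.X := by
  have hdeg : (Polynomial.X ^ q - Polynomial.X : Polynomial A).natDegree = q := by
    rw [Polynomial.natDegree_sub_eq_left_of_natDegree_lt] <;>
      simp [Polynomial.natDegree_X_pow, Polynomial.natDegree_X, hq]
  ext i
  rw [Polynomial.coeff_scaleRoots, hdeg]
  simp only [Polynomial.coeff_sub, Polynomial.coeff_X_pow, Polynomial.coeff_X,
    Polynomial.coeff_C_mul]
  have hq1 : (1 : ℕ) ≠ q := (Nat.ne_of_gt hq).symm
  by_cases hi : i = q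
  · subst hi
    simp [hq1]
  · by_cases hi1 : i = 1
    · subst hi1
      simp [hq1]
    · simp [hi, Ne.symm hi1]

/-- **`θ` is the product of the `q + 1` rational linear forms** [folklore; Dickson]: in `K[X, Y]`,
`K` a finite field with `q` elements, `Y · ∏_{a ∈ K} (X − aY) = X^q Y − X Y^q` — one linear form
`ℓ_P` for each point `P` of `ℙ¹(K)` (`Y` for `P = ∞ = [1:0]`, `X − aY` for `P = [a:1]`).  Hence a binary
form vanishing at all `K`-rational points of `ℙ¹` is divisible by `θ`, and `Sym^M/θ·Sym^{M−q−1}`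
(`M ≥ q`) is the space of functions on the `K`-points of the tautological cone, a principal series
of `GL₂(K)`.  Proof: push `∏_{a}(T − a) = T^q − T` into `(K[X,Y])[T]`, homogenise both sides with
`scaleRoots · Y`, evaluate at `T = X`. -/
theorem X_mul_prod_linear_forms_eq_theta (K : Type*) [Field K] [Fintype K] :
    (X 1 * ∏ a : K, (X 0 - C a * X 1) : MvPolynomial (Fin 2) K) =
      X 0 ^ Fintype.card K * X 1 - X 0 * X 1 ^ Fintype.card K := by
  have hq1 : 1 < Fintype.card K := Fintype.one_lt_card
  have h1 : (∏ a : K, (Polynomial.X - Polynomial.C (C a)) : Polynomial (MvPolynomial (Fin 2) K)) =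
      Polynomial.X ^ Fintype.card K - Polynomial.X := by
    have := congr_arg (Polynomial.map (C : K →+* MvPolynomial (Fin 2) K))
      (prod_X_sub_C_eq_X_pow_card_sub_X K)
    simpa [Polynomial.map_prod] using this
  have h2 : ((∏ a : K, (Polynomial.X - Polynomial.C (C a)) :
      Polynomial (MvPolynomial (Fin 2) K)).scaleRoots (X 1)) =
      ∏ a : K, (Polynomial.X - Polynomial.C (C a * X 1)) := by
    rw [prod_scaleRoots]
    exact Finset.prod_congr rfl fun a _ => Polynomial.X_sub_C_scaleRoots _ _
  have h3 := scaleRoots_X_pow_sub_X (Fintype.card K) hq1 (X 1 : MvPolynomial (Fin 2) K)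
  have h4 : (∏ a : K, (X 0 - C a * X 1) : MvPolynomial (Fin 2) K) =
      X 0 ^ Fintype.card K - X 1 ^ (Fintype.card K - 1) * X 0 := by
    have := congr_arg (Polynomial.eval (X 0 : MvPolynomial (Fin 2) K)) (h2.symm.trans (h1 ▸ h3))
    simpa [Polynomial.eval_prod] using this
  rw [h4, mul_sub, ← mul_assoc, ← pow_succ', Nat.sub_add_cancel hq1.le]
  ring

/-! ### Type arithmetic: torsion types of `μ_{q-1}²` versus the determinant -/

/-- Of the `m²` characters of `μ_m²` (pairs of exponents `(e₁, e₂) ∈ (ℤ/m)²`) exactly `m` have a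
prescribed product, i.e. a prescribed sum `e₁ + e₂ = c` of exponents [folklore] — for `m = q − 1`
this is the route's count of the torsion types of `(F_ṽ×)²` (unramified `F_ṽ`) compatible with
`det ρ̄_ṽ`: `q − 1` out of `(q − 1)²`. -/
theorem card_types_with_fixed_det (m : ℕ) [NeZero m] (c : ZMod m) :
    (Finset.univ.filter fun e : ZMod m × ZMod m => e.1 + e.2 = c).card = m := by
  have : (Finset.univ.filter fun e : ZMod m × ZMod m => e.1 + e.2 = c) =
      Finset.univ.image fun a : ZMod m => (a, c - a) := by
    ext ⟨x, y⟩
    simp only [Finset.mem_filter, Finset.mem_univ, true_and, Finset.mem_image, Prod.mk.injEq]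
    constructor
    · rintro rfl
      exact ⟨x, rfl, by ring⟩
    · rintro ⟨a, rfl, rfl⟩
      ring
  rw [this, Finset.card_image_of_injective _ fun a b h => (Prod.mk.inj h).1]
  simp

/-- The θ-tower sweeps a whole determinant class of types [folklore]: every pair `(e₁', e₂')` with
`e₁' + e₂' = e₁ + e₂` in `(ℤ/m)²` is `(e₁ + j, e₂ − j)` for some `0 ≤ j < m` (with `m = q − 1`:
the `j`-th θ-shift of an algebraic weight of tame type `(e₁, e₂)` has tame type `(e₁', e₂')`, so
`q − 1` consecutive shifts reach every determinant-compatible tame type). -/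
theorem exists_shift_of_det_eq (m : ℕ) [NeZero m] (e₁ e₂ e₁' e₂' : ZMod m)
    (h : e₁' + e₂' = e₁ + e₂) : ∃ j : ℕ, j < m ∧ e₁' = e₁ + j ∧ e₂' = e₂ - j := by
  refine ⟨(e₁' - e₁).val, ZMod.val_lt _, ?_, ?_⟩
  · rw [ZMod.natCast_zmod_val]; ring
  · rw [ZMod.natCast_zmod_val]
    linear_combination h

/-! ### Equivariance of the θ-multiplication and vanishing on the rational cone
(appended 2026-08-16 by the c1 prover seat of stmt-Langlands-8609; the statements the docstrings above
invoke when they call `f ↦ θ f` an equivariant embedding `Sym^N ⊗ det ↪ Sym^{N+q+1}`) -/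

/-- **Equivariance of multiplication by `θ`** [folklore]: for a finite field `K` with `q` elements,
a commutative `K`-algebra `R`, a matrix `g ∈ M₂(K)` and any `f ∈ R[X, Y]`, substituting
`X ↦ g₀₀X + g₀₁Y`, `Y ↦ g₁₀X + g₁₁Y` in `θ · f` gives `det(g) · θ · (f ∘ g)`.  In representation-
theoretic terms: `f ↦ θ f` is a `GL₂(K)`-equivariant map `Sym^N(R²) ⊗ det → Sym^{N+q+1}(R²)` of
spaces of binary forms (the weight-shifting map of the θ-tower in the seeding argument for
`TypeSeeds`).  Immediate from `theta_linear_substitution_finiteField` since substitution is a ring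
homomorphism. -/
theorem theta_mul_linear_substitution_finiteField {K R : Type*} [Field K] [Fintype K] [CommRing R]
    [Algebra K R] (g : Matrix (Fin 2) (Fin 2) K) (f : MvPolynomial (Fin 2) R) :
    bind₁ (![C (algebraMap K R (g 0 0)) * X 0 + C (algebraMap K R (g 0 1)) * X 1,
             C (algebraMap K R (g 1 0)) * X 0 + C (algebraMap K R (g 1 1)) * X 1] :
            Fin 2 → MvPolynomial (Fin 2) R)
        ((X 0 ^ Fintype.card K * X 1 - X 0 * X 1 ^ Fintype.card K) * f) =
      C (algebraMap K R g.det) *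
        ((X 0 ^ Fintype.card K * X 1 - X 0 * X 1 ^ Fintype.card K) *
          bind₁ (![C (algebraMap K R (g 0 0)) * X 0 + C (algebraMap K R (g 0 1)) * X 1,
                   C (algebraMap K R (g 1 0)) * X 0 + C (algebraMap K R (g 1 1)) * X 1] :
                  Fin 2 → MvPolynomial (Fin 2) R) f) := by
  rw [map_mul, theta_linear_substitution_finiteField, mul_assoc]

/-- Multiplication by `θ = X^q Y − X Y^q` raises the degree of a binary form by `q + 1` [folklore]:
if `f` is homogeneous of degree `N` then `θ f` is homogeneous of degree `q + 1 + N`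
(so `f ↦ θ f` maps `Sym^N` to `Sym^{N+q+1}`). -/
theorem isHomogeneous_theta_mul {R : Type*} [CommRing R] (q : ℕ) {f : MvPolynomial (Fin 2) R}
    {N : ℕ} (hf : f.IsHomogeneous N) :
    ((X 0 ^ q * X 1 - X 0 * X 1 ^ q) * f).IsHomogeneous (q + 1 + N) :=
  (theta_isHomogeneous q).mul hf

/-- `θ = X^q Y − X Y^q` vanishes at every `K`-rational point [folklore] (`K` finite with `q`
elements: `a^q b − a b^q = ab − ab = 0`); together with `X_mul_prod_linear_forms_eq_theta` this is
why `θ · Sym^{M−q−1}` is exactly the space of binary forms of degree `M` vanishing on the rational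
cone, and `Sym^M / θ · Sym^{M−q−1}` (`M ≥ q`) the functions on it — a principal series of `GL₂(K)`. -/
theorem eval_theta_eq_zero (K : Type*) [Field K] [Fintype K] (v : Fin 2 → K) :
    eval v (X 0 ^ Fintype.card K * X 1 - X 0 * X 1 ^ Fintype.card K : MvPolynomial (Fin 2) K) =
      0 := by
  simp [FiniteField.pow_card]

/-- Hence every multiple `θ f` vanishes on all `K`-rational points [folklore]. -/
theorem eval_theta_mul_eq_zero (K : Type*) [Field K] [Fintype K] (v : Fin 2 → K)
    (f : MvPolynomial (Fin 2) K) :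
    eval v ((X 0 ^ Fintype.card K * X 1 - X 0 * X 1 ^ Fintype.card K) * f) = 0 := by
  rw [map_mul, eval_theta_eq_zero, zero_mul]

end Summit.Langlands.Langlands.Theorems.TypeSeeds
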